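import Summits.QuantumFields.YangMills.Theorems.UnitScaleTiltProp7CombFrameRem2OfRegPrT3
import Summits.QuantumFields.YangMills.Theorems.UnitScaleTiltProp7HDOfCombRowRem2RowsT3
import HarnessLib

/-!
# Route `UnitScaleTilt`, crux K1 «MinimiserStabilityRegPr» (stmt-QuantumFields-19200), route-R E′ (A′)-on-Σ, P-A2 row (β) of ✓p698006 — file «(β)-ASSEMBLY G3-c»:
# **THE «REM2ᶜ» ROW OF ✓p705268 `hD_of_hMcomb_of_rem2Rows` FROM THE TWO COMB ROWS `hMc` («hMcomb») AND `hMc₂` («hMcomb₂»)** — px17 g4's member theorem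
# ✓`Prop7CombFrameRem2OfRegPrT3.sum_norm_frameTw_sub_one_sub_fderiv_le_of_regPr` (F-γᶜ3c: REM2ᶜ ⟸ {hMcomb, hMcomb₂}, kinematics discharged by ★routeR-w2 g9 ✓p705576) packaged on the
# `hcoS`∕`hD` binder in `X`-letters.

Cell `ym3-torus` (HUMAN RULING D-0037: YM₃ on the torus is ladder rung R3 — not d = 4, not a mass gap, not Clay), width seat `ym3-torus-px16` (gen 5).  `--supports stmt-QuantumFields-19200
--as helper`; THEOREMS ONLY (0 `def`, 0 `sorry`); count-neutral.

* ★★★ `hRc_of_hMcomb_hMcomb₂ (hMc) (hMc₂) : ⟨✓p705268's `hRc` row VERBATIM⟩` — per `(L, B₁′)`: radius `eR := min (min eC e₂) T⁻¹`, `T := 10⁷L⁴(12B₁′ + 1)`; per member `ε₀ := (12B₁′ + 1)·e`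
  (lit ✓`regPr_mono`; `nMax19 X < 2B₁′e < ε₀∕6` from (19)), `Am := A·M`, `Bm := B·(K+DIV) + B′·(ℓ²)⁻¹·M`, `Am₂ := A₂·M`, `Bm₂ := B₂·(K+DIV) + B₂′·(ℓ²)⁻¹·M`; no currency exchange needed.
DISPLAYED ROWS (OPEN, route-internal, L; ★★OWNER RULING №20 (1) labels; ★routeR-w6 SIGNATURE-0 ∕ px13 SIGNATURE-0′ summands TOKEN FOR TOKEN at `A := fun b ↦ I•X b`, X-letter constants):
`hMc` («hMcomb»): `∀ l < K − n, Σ_{z,κ} ‖Ũ^{(l)}_{z,κ}(iX) − 1‖² ≤ A·M·(Lˡ)⁻¹ + (B·(K+DIV) + B′·(ℓ²)⁻¹·M)·Lˡ`;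
`hMc₂` («hMcomb₂»): `∀ l < K − n, Σ_{z,κ} ‖Ũ^{(l)}_{z,κ}(iX) − 1 − D[Ũ^{(l)}_{z,κ}](0)(iX)‖ ≤ A₂·M·(Lˡ)⁻¹ + (B₂·(K+DIV) + B₂′·(ℓ²)⁻¹·M)·Lˡ`.

HONEST SCOPE.  Bookkeeping; the displayed rows are OPEN (lane (II), ★routeR-w1 g9 F-0…F-8 ∕ H2-1); nothing of REM2ᶜ's analytic content, (β), hPA2, hcoS, E′, EX or the crux is proved here;
YM₃ on T³ is rung R3 — NOT d = 4, NOT infinite volume, NOT a mass gap, NOT Clay.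
[cite: Balaban1985Variational, (2) p.278, (19)-(20) p.281, (44)-(48) pp.285-286; Balaban1985Averaging, (26)-(27) p.22, (89)-(92) p.31, (97) p.32, (161)-(163) p.42]
-/

noncomputable section

open scoped BigOperators Matrix.Norms.L2Operator Matrix Topology InnerProductSpace
open Filter NormedSpace

namespace Summit.QuantumFields.YangMills.Theorems.Prop7CombFrameRem2RowOfCombRows

open Literature.MathematicalPhysics.QuantumFieldTheory.Balaban1983to89
open Literature.MathematicalPhysics.QuantumFieldTheory.Balaban1983to89.T3ContinuumYM3Torus
open Literature.MathematicalPhysics.QuantumFieldTheory.Balaban1983to89.T3UnitLawDensityEML (ℰp)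
open Literature.MathematicalPhysics.QuantumFieldTheory.Balaban1983to89.T3ConstrainedMinimiser (fibre)
open Literature.MathematicalPhysics.QuantumFieldTheory.Balaban1983to89.T3PrintedRegularMinimiser
open Literature.MathematicalPhysics.QuantumFieldTheory.Balaban1983to89.T3PrintedMinimiserExistence (regPr_mono)
open Literature.MathematicalPhysics.QuantumFieldTheory.Balaban1983to89.T3RegularMinimiser
open Literature.MathematicalPhysics.QuantumFieldTheory.Balaban1983to89.T3Thm1Carrier
open T4Continuum BlockAveraging AveragingRT ExpMeanLog BlockAveragingEMLLinearised BlockAveragingEMLLinearisedBackground BlockAveragingEMLProp2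
open B7Prop1Explicit (expUnit)
open B7Eq92Concrete (tildIter vcov)
open B10Eq27TorusAxialLog (pull unitsField toUField)
open B9Eq39Adjoint (divB)
open B9TorusCalculus (torusT)
open T3SectALandauChart (emb15 eta eta_pos bgUnits In19)
open B11Eq103H1Complex (BondL2K laplaceAK)
open Summit.QuantumFields.YangMills.Theorems.Prop7SPrint (basePt RestrictedPrint AvgCondPrint IsLandauPrint)
open Summit.QuantumFields.YangMills.Theorems.Prop7TPrint (expHermField nMax19 nMax19_lt_iff)
open Summit.QuantumFields.YangMills.Theorems.Prop7SymAvgTw (frameTw QTw CmapTw)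
open Summit.QuantumFields.YangMills.Theorems.Prop7SymAvgTwSym (frameTwS CmapTwS)
open Summit.QuantumFields.YangMills.Theorems.Prop7HcoSEndToEnd (summand_window)

/-- ★★★ **THE «REM2ᶜ» ROW FROM THE TWO COMB ROWS** — conclusion = ✓p705268 `hD_of_hMcomb_of_rem2Rows`'s hypothesis `hRc` VERBATIM; hypotheses = the displayed OPEN rows `hMc`, `hMc₂`
(docstring above).  px17 g4 F-γᶜ3c ✓`Prop7CombFrameRem2OfRegPrT3.sum_norm_frameTw_sub_one_sub_fderiv_le_of_regPr` at `ε₀ := (12B₁′+1)·e`, `Am := A·M`, `Bm := B·(K+DIV) + B′·(ℓ²)⁻¹·M`,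
`Am₂ := A₂·M`, `Bm₂ := B₂·(K+DIV) + B₂′·(ℓ²)⁻¹·M`.
[cite: Balaban1985Variational, (2) p.278, (19)-(20) p.281, (44)-(48) pp.285-286; Balaban1985Averaging, (89)-(92) p.31, (97) p.32, (161)-(163) p.42] -/
theorem hRc_of_hMcomb_hMcomb₂
    (hMc : ∀ (L : ℕ), 1 < L → ∀ (B₁' : ℝ), 0 < B₁' → ∃ eC A B B' : ℝ, 0 < eC ∧ 0 ≤ A ∧ 0 ≤ B ∧ 0 ≤ B' ∧
      ∀ (F : T3Family), F.L = L → ∀ (n K : ℕ) (hnK : n < K) (e : ℝ) (V : GaugeField (F.P n) 0 (Matrix.specialUnitaryGroup (Fin 2) ℂ))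
        (W : GaugeField (F.P K) 0 (Matrix.specialUnitaryGroup (Fin 2) ℂ)) (X : PBond (F.P K) 0 → Matrix (Fin 2) (Fin 2) ℂ),
        0 < e → e ≤ eC → W ∈ regFibrePr F n K hnK.le e V →
        (∀ γ : ℝ → GaugeField (F.P K) 0 (Matrix.specialUnitaryGroup (Fin 2) ℂ), γ 0 = W → (∀ t, γ t ∈ fibre F ℰp n K hnK.le V) →
          (∀ b, DifferentiableAt ℝ (fun t => ((γ t b : Matrix.specialUnitaryGroup (Fin 2) ℂ) : Matrix (Fin 2) (Fin 2) ℂ)) 0) →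
            deriv (fun t => wilsonAction4 (γ t)) 0 = 0) →
        In19 F n K (2 * B₁' * e) W (expHermField X) X → AvgCondPrint F n K hnK.le V W X → IsLandauPrint F n K W X →
          ∀ l : ℕ, l < K - n →
            ∑ z : Site (F.P K) l, ∑ κ : Fin (F.P K).d,
              ‖((tildIter (F.P K).L (pull (bgUnits F K W) (basePt F n K)) (pull (fun b => expUnit (Complex.I • X b)) (basePt F n K)) l
              (fun μ => ((z μ).val : ℤ)) κ : (Matrix (Fin 2) (Fin 2) ℂ)ˣ) : Matrix (Fin 2) (Fin 2) ℂ) - 1‖ ^ 2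
              ≤ A * (∑ b : PBond (F.P K) 0, ‖X b‖ ^ 2) * ((F.L : ℝ) ^ l)⁻¹
                + (B * ((∑ p : Plaq (F.P K) 0, ‖((Complex.I • X ⟨p.src, p.μ⟩) + ((W ⟨p.src, p.μ⟩ : Matrix (Fin 2) (Fin 2) ℂ) * (Complex.I • X ⟨p.src.shift p.μ, p.ν⟩) * star (W ⟨p.src, p.μ⟩ : Matrix (Fin 2) (Fin 2) ℂ))
            - (((W ⟨p.src, p.μ⟩ * W ⟨p.src.shift p.μ, p.ν⟩ * (W ⟨p.src.shift p.ν, p.μ⟩)⁻¹ : Matrix.specialUnitaryGroup (Fin 2) ℂ) : Matrix (Fin 2) (Fin 2) ℂ) * (Complex.I • X ⟨p.src.shift p.ν, p.μ⟩) * star ((W ⟨p.src, p.μ⟩ * W ⟨p.src.shift p.μ, p.ν⟩ * (W ⟨p.src.shift p.ν, p.μ⟩)⁻¹ : Matrix.specialUnitaryGroup (Fin 2) ℂ) : Matrix (Fin 2) (Fin 2) ℂ))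
            - (((GaugeField.plaqHol W p : Matrix.specialUnitaryGroup (Fin 2) ℂ) : Matrix (Fin 2) (Fin 2) ℂ) * (Complex.I • X ⟨p.src, p.ν⟩) * star ((GaugeField.plaqHol W p : Matrix.specialUnitaryGroup (Fin 2) ℂ) : Matrix (Fin 2) (Fin 2) ℂ)))‖ ^ 2) + (∑ x : Site (F.P K) 0, ∑ j : Fin 2, ∑ k : Fin 2,
              ‖(divB (torusT (F.P K) 0) (fun κ z => unitsField (toUField W) ⟨z, κ⟩) (fun κ z => Complex.I • X ⟨z, κ⟩) x) j k‖ ^ 2))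
                  + B' * (((F.L : ℝ) ^ (K - n)) ^ 2)⁻¹ * (∑ b : PBond (F.P K) 0, ‖X b‖ ^ 2)) * (F.L : ℝ) ^ l)
    (hMc₂ : ∀ (L : ℕ), 1 < L → ∀ (B₁' : ℝ), 0 < B₁' → ∃ e₂ A₂ B₂ B₂' : ℝ, 0 < e₂ ∧ 0 ≤ A₂ ∧ 0 ≤ B₂ ∧ 0 ≤ B₂' ∧
      ∀ (F : T3Family), F.L = L → ∀ (n K : ℕ) (hnK : n < K) (e : ℝ) (V : GaugeField (F.P n) 0 (Matrix.specialUnitaryGroup (Fin 2) ℂ))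
        (W : GaugeField (F.P K) 0 (Matrix.specialUnitaryGroup (Fin 2) ℂ)) (X : PBond (F.P K) 0 → Matrix (Fin 2) (Fin 2) ℂ),
        0 < e → e ≤ e₂ → W ∈ regFibrePr F n K hnK.le e V →
        (∀ γ : ℝ → GaugeField (F.P K) 0 (Matrix.specialUnitaryGroup (Fin 2) ℂ), γ 0 = W → (∀ t, γ t ∈ fibre F ℰp n K hnK.le V) →
          (∀ b, DifferentiableAt ℝ (fun t => ((γ t b : Matrix.specialUnitaryGroup (Fin 2) ℂ) : Matrix (Fin 2) (Fin 2) ℂ)) 0) →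
            deriv (fun t => wilsonAction4 (γ t)) 0 = 0) →
        In19 F n K (2 * B₁' * e) W (expHermField X) X → AvgCondPrint F n K hnK.le V W X → IsLandauPrint F n K W X →
          ∀ l : ℕ, l < K - n →
            ∑ z : Site (F.P K) l, ∑ κ : Fin (F.P K).d,
              ‖((tildIter (F.P K).L (pull (bgUnits F K W) (basePt F n K)) (pull (fun b => expUnit (Complex.I • X b)) (basePt F n K)) l
              (fun μ => ((z μ).val : ℤ)) κ : (Matrix (Fin 2) (Fin 2) ℂ)ˣ) : Matrix (Fin 2) (Fin 2) ℂ) - 1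
            - (fderiv ℂ (fun A' : PBond (F.P K) 0 → Matrix (Fin 2) (Fin 2) ℂ =>
                ((tildIter (F.P K).L (pull (bgUnits F K W) (basePt F n K)) (pull (fun b => expUnit (A' b)) (basePt F n K)) l (fun μ => ((z μ).val : ℤ)) κ :
                  (Matrix (Fin 2) (Fin 2) ℂ)ˣ) : Matrix (Fin 2) (Fin 2) ℂ)) 0) (fun b => Complex.I • X b)‖
              ≤ A₂ * (∑ b : PBond (F.P K) 0, ‖X b‖ ^ 2) * ((F.L : ℝ) ^ l)⁻¹
                + (B₂ * ((∑ p : Plaq (F.P K) 0, ‖((Complex.I • X ⟨p.src, p.μ⟩) + ((W ⟨p.src, p.μ⟩ : Matrix (Fin 2) (Fin 2) ℂ) * (Complex.I • X ⟨p.src.shift p.μ, p.ν⟩) * star (W ⟨p.src, p.μ⟩ : Matrix (Fin 2) (Fin 2) ℂ))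
            - (((W ⟨p.src, p.μ⟩ * W ⟨p.src.shift p.μ, p.ν⟩ * (W ⟨p.src.shift p.ν, p.μ⟩)⁻¹ : Matrix.specialUnitaryGroup (Fin 2) ℂ) : Matrix (Fin 2) (Fin 2) ℂ) * (Complex.I • X ⟨p.src.shift p.ν, p.μ⟩) * star ((W ⟨p.src, p.μ⟩ * W ⟨p.src.shift p.μ, p.ν⟩ * (W ⟨p.src.shift p.ν, p.μ⟩)⁻¹ : Matrix.specialUnitaryGroup (Fin 2) ℂ) : Matrix (Fin 2) (Fin 2) ℂ))
            - (((GaugeField.plaqHol W p : Matrix.specialUnitaryGroup (Fin 2) ℂ) : Matrix (Fin 2) (Fin 2) ℂ) * (Complex.I • X ⟨p.src, p.ν⟩) * star ((GaugeField.plaqHol W p : Matrix.specialUnitaryGroup (Fin 2) ℂ) : Matrix (Fin 2) (Fin 2) ℂ)))‖ ^ 2) + (∑ x : Site (F.P K) 0, ∑ j : Fin 2, ∑ k : Fin 2,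
              ‖(divB (torusT (F.P K) 0) (fun κ z => unitsField (toUField W) ⟨z, κ⟩) (fun κ z => Complex.I • X ⟨z, κ⟩) x) j k‖ ^ 2))
                  + B₂' * (((F.L : ℝ) ^ (K - n)) ^ 2)⁻¹ * (∑ b : PBond (F.P K) 0, ‖X b‖ ^ 2)) * (F.L : ℝ) ^ l) :
    ∀ (L : ℕ), 1 < L → ∀ (B₁' : ℝ), 0 < B₁' → ∃ eR Cc₁ Cc₂ : ℝ, 0 < eR ∧ 0 ≤ Cc₁ ∧ 0 ≤ Cc₂ ∧
      ∀ (F : T3Family), F.L = L → ∀ (n K : ℕ) (hnK : n < K) (e : ℝ) (V : GaugeField (F.P n) 0 (Matrix.specialUnitaryGroup (Fin 2) ℂ))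
        (W : GaugeField (F.P K) 0 (Matrix.specialUnitaryGroup (Fin 2) ℂ)) (X : PBond (F.P K) 0 → Matrix (Fin 2) (Fin 2) ℂ),
        0 < e → e ≤ eR → W ∈ regFibrePr F n K hnK.le e V →
        (∀ γ : ℝ → GaugeField (F.P K) 0 (Matrix.specialUnitaryGroup (Fin 2) ℂ), γ 0 = W → (∀ t, γ t ∈ fibre F ℰp n K hnK.le V) →
          (∀ b, DifferentiableAt ℝ (fun t => ((γ t b : Matrix.specialUnitaryGroup (Fin 2) ℂ) : Matrix (Fin 2) (Fin 2) ℂ)) 0) →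
            deriv (fun t => wilsonAction4 (γ t)) 0 = 0) →
        In19 F n K (2 * B₁' * e) W (expHermField X) X → AvgCondPrint F n K hnK.le V W X → IsLandauPrint F n K W X →
          ∑ y : Site (F.P n) 0, ‖((frameTw F n K hnK.le W (fun b => Complex.I • X b) y : (Matrix (Fin 2) (Fin 2) ℂ)ˣ) : Matrix (Fin 2) (Fin 2) ℂ) - 1
            - fderiv ℂ (fun A : PBond (F.P K) 0 → Matrix (Fin 2) (Fin 2) ℂ => ((frameTw F n K hnK.le W A y : (Matrix (Fin 2) (Fin 2) ℂ)ˣ) : Matrix (Fin 2) (Fin 2) ℂ)) 0 (fun b => Complex.I • X b)‖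
            ≤ Cc₁ * ((F.L : ℝ) ^ (K - n))⁻¹ * (∑ b : PBond (F.P K) 0, ‖X b‖ ^ 2) + Cc₂ * ((F.L : ℝ) ^ (K - n)) * ((∑ p : Plaq (F.P K) 0, ‖((Complex.I • X ⟨p.src, p.μ⟩) + ((W ⟨p.src, p.μ⟩ : Matrix (Fin 2) (Fin 2) ℂ) * (Complex.I • X ⟨p.src.shift p.μ, p.ν⟩) * star (W ⟨p.src, p.μ⟩ : Matrix (Fin 2) (Fin 2) ℂ))
            - (((W ⟨p.src, p.μ⟩ * W ⟨p.src.shift p.μ, p.ν⟩ * (W ⟨p.src.shift p.ν, p.μ⟩)⁻¹ : Matrix.specialUnitaryGroup (Fin 2) ℂ) : Matrix (Fin 2) (Fin 2) ℂ) * (Complex.I • X ⟨p.src.shift p.ν, p.μ⟩) * star ((W ⟨p.src, p.μ⟩ * W ⟨p.src.shift p.μ, p.ν⟩ * (W ⟨p.src.shift p.ν, p.μ⟩)⁻¹ : Matrix.specialUnitaryGroup (Fin 2) ℂ) : Matrix (Fin 2) (Fin 2) ℂ))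
            - (((GaugeField.plaqHol W p : Matrix.specialUnitaryGroup (Fin 2) ℂ) : Matrix (Fin 2) (Fin 2) ℂ) * (Complex.I • X ⟨p.src, p.ν⟩) * star ((GaugeField.plaqHol W p : Matrix.specialUnitaryGroup (Fin 2) ℂ) : Matrix (Fin 2) (Fin 2) ℂ)))‖ ^ 2) + (∑ x : Site (F.P K) 0, ∑ j : Fin 2, ∑ k : Fin 2,
              ‖(divB (torusT (F.P K) 0) (fun κ z => unitsField (toUField W) ⟨z, κ⟩) (fun κ z => Complex.I • X ⟨z, κ⟩) x) j k‖ ^ 2)) := by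
  intro L hL B₁' hB₁'
  obtain ⟨eC, A, B, B', heC, hA0, hB0, hB'0, hMcL⟩ := hMc L hL B₁' hB₁'
  obtain ⟨e₂, A₂, B₂, B₂', he₂, hA₂, hB₂, hB₂', hMc₂L⟩ := hMc₂ L hL B₁' hB₁'
  have hL0 : (0 : ℝ) < (L : ℝ) := by exact_mod_cast (show 0 < L by omega)
  obtain ⟨T, hT_def⟩ : ∃ T : ℝ, T = 10 ^ 7 * (L : ℝ) ^ 4 * (12 * B₁' + 1) := ⟨_, rfl⟩
  have hTpos : 0 < T := by rw [hT_def]; positivity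
  refine ⟨min (min eC e₂) T⁻¹,
    2 * (L : ℝ) * (477 * (L : ℝ) ^ 2 * A + 3 * (L : ℝ) * A₂ + 49 * (220 * (L : ℝ) ^ 3 * A))
      + (477 * (L : ℝ) ^ 2 * B' + 3 * (L : ℝ) * B₂' + 49 * (110 * (L : ℝ) ^ 2 * B')),
    477 * (L : ℝ) ^ 2 * B + 3 * (L : ℝ) * B₂ + 49 * (110 * (L : ℝ) ^ 2 * B),
    lt_min (lt_min heC he₂) (inv_pos.mpr hTpos), by positivity, by positivity, ?_⟩
  intro F hF n K hnK e V W X he heR hWreg hEL h19 h20 h21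
  have heC' : e ≤ eC := heR.trans ((min_le_left _ _).trans (min_le_left _ _))
  have he₂' : e ≤ e₂ := heR.trans ((min_le_left _ _).trans (min_le_right _ _))
  have heT : e ≤ T⁻¹ := heR.trans (min_le_right _ _)
  have hTe : T * e ≤ 1 := by
    calc T * e ≤ T * T⁻¹ := mul_le_mul_of_nonneg_left heT hTpos.le
      _ = 1 := mul_inv_cancel₀ hTpos.ne'
  have w4 : 10 ^ 7 * (L : ℝ) ^ 4 * (12 * B₁' + 1) * e ≤ 1 := by rw [← hT_def]; exact hTe
  have hMcM := hMcL F hF n K hnK e V W X he heC' hWreg hEL h19 h20 h21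
  have hMc₂M := hMc₂L F hF n K hnK e V W X he he₂' hWreg hEL h19 h20 h21
  subst hF
  obtain ⟨-, hreg⟩ := (mem_regFibrePr_iff F).mp hWreg
  have hℓ0 : (0 : ℝ) < (F.L : ℝ) ^ (K - n) := by positivity
  have hD : ∀ b : PBond (F.P K) 0, (X b).IsHermitian ∧ Matrix.trace (X b) = 0 := h19.1
  -- the member radius `ε₀ := (12B₁′ + 1)·e`
  have h12 : 0 < (12 * B₁' + 1) * e := by positivity
  have hreg12 : RegPr F n K ((12 * B₁' + 1) * e) W := regPr_mono F (by nlinarith) hreg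
  have hε7 : 10 ^ 7 * (F.L : ℝ) ^ 4 * ((12 * B₁' + 1) * e) ≤ 1 := by
    calc 10 ^ 7 * (F.L : ℝ) ^ 4 * ((12 * B₁' + 1) * e) = 10 ^ 7 * (F.L : ℝ) ^ 4 * (12 * B₁' + 1) * e := by ring
      _ ≤ 1 := w4
  have hX6 : nMax19 F n K W X < (12 * B₁' + 1) * e / 6 := by
    have hlt : nMax19 F n K W X < 2 * B₁' * e :=
      (nMax19_lt_iff (F := F) (n := n) (K := K)).mpr ⟨h19.2.2.1, h19.2.2.2.1, h19.2.2.2.2.1, h19.2.2.2.2.2⟩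
    have : 2 * B₁' * e ≤ (12 * B₁' + 1) * e / 6 := by nlinarith
    exact hlt.trans_le this
  -- the letters `Am Bm Am₂ Bm₂`
  have hM0 : 0 ≤ (∑ b : PBond (F.P K) 0, ‖X b‖ ^ 2) := Finset.sum_nonneg fun _ _ => sq_nonneg _
  have hKD0 : 0 ≤ ((∑ p : Plaq (F.P K) 0, ‖((Complex.I • X ⟨p.src, p.μ⟩) + ((W ⟨p.src, p.μ⟩ : Matrix (Fin 2) (Fin 2) ℂ) * (Complex.I • X ⟨p.src.shift p.μ, p.ν⟩) * star (W ⟨p.src, p.μ⟩ : Matrix (Fin 2) (Fin 2) ℂ))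
            - (((W ⟨p.src, p.μ⟩ * W ⟨p.src.shift p.μ, p.ν⟩ * (W ⟨p.src.shift p.ν, p.μ⟩)⁻¹ : Matrix.specialUnitaryGroup (Fin 2) ℂ) : Matrix (Fin 2) (Fin 2) ℂ) * (Complex.I • X ⟨p.src.shift p.ν, p.μ⟩) * star ((W ⟨p.src, p.μ⟩ * W ⟨p.src.shift p.μ, p.ν⟩ * (W ⟨p.src.shift p.ν, p.μ⟩)⁻¹ : Matrix.specialUnitaryGroup (Fin 2) ℂ) : Matrix (Fin 2) (Fin 2) ℂ))
            - (((GaugeField.plaqHol W p : Matrix.specialUnitaryGroup (Fin 2) ℂ) : Matrix (Fin 2) (Fin 2) ℂ) * (Complex.I • X ⟨p.src, p.ν⟩) * star ((GaugeField.plaqHol W p : Matrix.specialUnitaryGroup (Fin 2) ℂ) : Matrix (Fin 2) (Fin 2) ℂ)))‖ ^ 2) + (∑ x : Site (F.P K) 0, ∑ j : Fin 2, ∑ k : Fin 2,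
              ‖(divB (torusT (F.P K) 0) (fun κ z => unitsField (toUField W) ⟨z, κ⟩) (fun κ z => Complex.I • X ⟨z, κ⟩) x) j k‖ ^ 2)) :=
    add_nonneg (Finset.sum_nonneg fun _ _ => sq_nonneg _)
      (Finset.sum_nonneg fun _ _ => Finset.sum_nonneg fun _ _ => Finset.sum_nonneg fun _ _ => sq_nonneg _)
  have hAm : 0 ≤ A * (∑ b : PBond (F.P K) 0, ‖X b‖ ^ 2) := mul_nonneg hA0 hM0
  have hBm : 0 ≤ B * ((∑ p : Plaq (F.P K) 0, ‖((Complex.I • X ⟨p.src, p.μ⟩) + ((W ⟨p.src, p.μ⟩ : Matrix (Fin 2) (Fin 2) ℂ) * (Complex.I • X ⟨p.src.shift p.μ, p.ν⟩) * star (W ⟨p.src, p.μ⟩ : Matrix (Fin 2) (Fin 2) ℂ))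
            - (((W ⟨p.src, p.μ⟩ * W ⟨p.src.shift p.μ, p.ν⟩ * (W ⟨p.src.shift p.ν, p.μ⟩)⁻¹ : Matrix.specialUnitaryGroup (Fin 2) ℂ) : Matrix (Fin 2) (Fin 2) ℂ) * (Complex.I • X ⟨p.src.shift p.ν, p.μ⟩) * star ((W ⟨p.src, p.μ⟩ * W ⟨p.src.shift p.μ, p.ν⟩ * (W ⟨p.src.shift p.ν, p.μ⟩)⁻¹ : Matrix.specialUnitaryGroup (Fin 2) ℂ) : Matrix (Fin 2) (Fin 2) ℂ))
            - (((GaugeField.plaqHol W p : Matrix.specialUnitaryGroup (Fin 2) ℂ) : Matrix (Fin 2) (Fin 2) ℂ) * (Complex.I • X ⟨p.src, p.ν⟩) * star ((GaugeField.plaqHol W p : Matrix.specialUnitaryGroup (Fin 2) ℂ) : Matrix (Fin 2) (Fin 2) ℂ)))‖ ^ 2) + (∑ x : Site (F.P K) 0, ∑ j : Fin 2, ∑ k : Fin 2,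
              ‖(divB (torusT (F.P K) 0) (fun κ z => unitsField (toUField W) ⟨z, κ⟩) (fun κ z => Complex.I • X ⟨z, κ⟩) x) j k‖ ^ 2))
                  + B' * (((F.L : ℝ) ^ (K - n)) ^ 2)⁻¹ * (∑ b : PBond (F.P K) 0, ‖X b‖ ^ 2) :=
    add_nonneg (mul_nonneg hB0 hKD0) (mul_nonneg (mul_nonneg hB'0 (inv_nonneg.mpr (sq_nonneg _))) hM0)
  have hAm₂ : 0 ≤ A₂ * (∑ b : PBond (F.P K) 0, ‖X b‖ ^ 2) := mul_nonneg hA₂ hM0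
  have hBm₂ : 0 ≤ B₂ * ((∑ p : Plaq (F.P K) 0, ‖((Complex.I • X ⟨p.src, p.μ⟩) + ((W ⟨p.src, p.μ⟩ : Matrix (Fin 2) (Fin 2) ℂ) * (Complex.I • X ⟨p.src.shift p.μ, p.ν⟩) * star (W ⟨p.src, p.μ⟩ : Matrix (Fin 2) (Fin 2) ℂ))
            - (((W ⟨p.src, p.μ⟩ * W ⟨p.src.shift p.μ, p.ν⟩ * (W ⟨p.src.shift p.ν, p.μ⟩)⁻¹ : Matrix.specialUnitaryGroup (Fin 2) ℂ) : Matrix (Fin 2) (Fin 2) ℂ) * (Complex.I • X ⟨p.src.shift p.ν, p.μ⟩) * star ((W ⟨p.src, p.μ⟩ * W ⟨p.src.shift p.μ, p.ν⟩ * (W ⟨p.src.shift p.ν, p.μ⟩)⁻¹ : Matrix.specialUnitaryGroup (Fin 2) ℂ) : Matrix (Fin 2) (Fin 2) ℂ))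
            - (((GaugeField.plaqHol W p : Matrix.specialUnitaryGroup (Fin 2) ℂ) : Matrix (Fin 2) (Fin 2) ℂ) * (Complex.I • X ⟨p.src, p.ν⟩) * star ((GaugeField.plaqHol W p : Matrix.specialUnitaryGroup (Fin 2) ℂ) : Matrix (Fin 2) (Fin 2) ℂ)))‖ ^ 2) + (∑ x : Site (F.P K) 0, ∑ j : Fin 2, ∑ k : Fin 2,
              ‖(divB (torusT (F.P K) 0) (fun κ z => unitsField (toUField W) ⟨z, κ⟩) (fun κ z => Complex.I • X ⟨z, κ⟩) x) j k‖ ^ 2))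
                  + B₂' * (((F.L : ℝ) ^ (K - n)) ^ 2)⁻¹ * (∑ b : PBond (F.P K) 0, ‖X b‖ ^ 2) :=
    add_nonneg (mul_nonneg hB₂ hKD0) (mul_nonneg (mul_nonneg hB₂' (inv_nonneg.mpr (sq_nonneg _))) hM0)
  -- px17 g4's member theorem at this datum
  have hmem := Prop7CombFrameRem2OfRegPrT3.sum_norm_frameTw_sub_one_sub_fderiv_le_of_regPr F hnK.le h12 hε7 W hreg12 X hD hX6 hAm hBm hAm₂ hBm₂ hMcM hMc₂M
  -- collect: `(ℓ²)⁻¹·M·ℓ = ℓ⁻¹·M`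
  have hinv : (((F.L : ℝ) ^ (K - n)) ^ 2)⁻¹ * (F.L : ℝ) ^ (K - n) = ((F.L : ℝ) ^ (K - n))⁻¹ := by
    rw [pow_two, mul_inv, mul_assoc, inv_mul_cancel₀ hℓ0.ne', mul_one]
  have e1 : (F.L : ℝ) ^ 2 * (B' * (((F.L : ℝ) ^ (K - n)) ^ 2)⁻¹ * (∑ b : PBond (F.P K) 0, ‖X b‖ ^ 2)) * (F.L : ℝ) ^ (K - n)
      = (F.L : ℝ) ^ 2 * B' * ((F.L : ℝ) ^ (K - n))⁻¹ * (∑ b : PBond (F.P K) 0, ‖X b‖ ^ 2) := by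
    rw [← hinv]; ring
  have e2 : (F.L : ℝ) * (B₂' * (((F.L : ℝ) ^ (K - n)) ^ 2)⁻¹ * (∑ b : PBond (F.P K) 0, ‖X b‖ ^ 2)) * (F.L : ℝ) ^ (K - n)
      = (F.L : ℝ) * B₂' * ((F.L : ℝ) ^ (K - n))⁻¹ * (∑ b : PBond (F.P K) 0, ‖X b‖ ^ 2) := by
    rw [← hinv]; ring
  linarith only [hmem, e1, e2]

-- KERNEL WITNESS (no new content): the conclusion IS ✓p705268's `hRc` slot.
example := fun hMc hMc₂ hRs => Prop7HDOfCombRowRem2Rows.hD_of_hMcomb_of_rem2Rows hMc hRs (hRc_of_hMcomb_hMcomb₂ hMc hMc₂)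

end Summit.QuantumFields.YangMills.Theorems.Prop7CombFrameRem2RowOfCombRows

end
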